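import Literature.NumberTheory.EllipticCurves.HeightConductorBoundsModularity
import Literature.NumberTheory.EllipticCurves.ModularCurveNonempty
import Literature.NumberTheory.EllipticCurves.PastenDiscriminantBoundAbcShapeProofs
import Mathlib.Analysis.Complex.ExponentialBounds
import Mathlib.Analysis.Real.Pi.Bounds
import HarnessLib

/-!
# von Känel–Matschke's discriminant–conductor inequality (eq:szpiro) from Prop. 10.8, and the
# modular method's `abc` shape `log c ≪ rad · log rad` from it (proofs)

Topic `Literature/NumberTheory/EllipticCurves` (family `abc`, LADDER-ABC A1: the *modular method*).
Theorems only — NO new statement (D-0026); the `Proofs` companion of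
`HeightConductorBoundsModularity.lean` (von Känel–Matschke, arXiv:1605.06079 = Mem. AMS **286**
(2023) no. 1419 [`VonkanelMatschke2023`], §10.5, arXiv numbering). It follows the printed deductions:

* `six_mul_vkmKappa_add_sixteen_le` — the printed numerics `6κ + 16 ≤ 115.1` for
  `κ = 4π + log(163/π)` (Remark 10.10ff: the constant of (eq:szpiro) is `12 · (κ/2) + 16`).
* `eleven_le_conductorNorm_of_modularity` — `N_E ≥ 11` for every elliptic curve over `ℚ`, from the
  tree's modularity fact `nonempty_modularParametrizationData` and its census of the genus-zero levels
  (`ModularParametrizationData_isEmpty_of_mem_genusZeroLevels`: `S₂(Γ₀(N)) = 0` for `N ≤ 10`).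
* `log_minimalDiscriminant_le_of_prop_10_8` — **(eq:szpiro) from Prop. 10.8 (i)+(ii)**, verbatim the
  printed sentence "Proposition 10.8 together with [vK 2014, `log Δ_E ≤ 12 h(E) + 16`] directly implies
  `log Δ_E ≤ ν log N + (3/8) ν log log log N + (2/3) ν + 115.1`": the named fact
  `vonKanelMatschke_log_minimalDiscriminant_le` follows from `vonKanelMatschke_prop_10_8_i`,
  `vonKanelMatschke_prop_10_8_ii`, modularity with an integral Manin constant
  (`nonempty_modularParametrizationData`, needed to attach a newform to `E` and for `N ≥ 11`) and
  Silverman's inequality (PROVED in the tree, `pasten2024_log_minimalDiscriminant_le_holds`).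
* `abcTriple_log_le_of_log_minimalDiscriminant_le` — **(eq:szpiro) alone gives
  `log c ≤ 10⁴ · rad(abc) log rad(abc)` for every `abc` triple**, through the tree's PROVED Frey
  model `exists_frey_model_sq_dvd` (`N ∣ 2¹⁰ rad`, `(abc)² ∣ 2⁸ Δ_min`; Bombieri–Gubler Ex. 12.5.10,
  Murty–Pasten §8); hence `Literature.Barriers.ABC.BakerShapeBound 1 1` and
  `Literature.Barriers.ABC.EpsShapeBound 1` (`…_of_log_minimalDiscriminant_le`).
* `epsShapeBound_one_of_modularity_of_prop_10_8` — **rung A1.P in ROOT-conditional kernel form,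
  von Känel–Matschke version**: `EpsShapeBound 1` BY NAME from {BCDT modularity, vKM Prop. 10.8 (i)
  (Frey–Faltings height vs. modular degree / congruence number), vKM Prop. 10.8 (ii) (explicit
  analytic bound for `β`)} — a second derivation, input-disjoint from the one through Pasten's
  spectral bound Thm 7.2 (`epsShapeBound_one_of_modularity_of_thm_7_2`). No linear forms in
  logarithms anywhere in its cone. Constants are crude (`10⁴`); vKM's sharp `(9/5) r log r` needs
  Lemma 10.5 (the `2`-adic refinement) and is not attempted here.

No `abc` claim: every bound here is EXPONENTIAL in the radical. Typed ≠ proved: the roots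
(modularity, Prop. 10.8 (i), (ii)) remain named facts.

## References

* [VonkanelMatschke2023] R. von Känel, B. Matschke, arXiv:1605.06079 = Mem. AMS 286 (2023),
  §10.5 (Prop. 10.8, Remark 10.10, display (eq:szpiro)) and §10.4 (Lemma 10.5, Prop. 10.6).
* [MurtyPasten2013] M. R. Murty, H. Pasten, J. Number Theory 133 (2013), §8.
* [BombieriGubler2006] E. Bombieri, W. Gubler, *Heights in Diophantine Geometry*, Ex. 12.5.10.
-/

noncomputable section

open WeierstrassCurve IsDedekindDomain

namespace Literature.NumberTheory.EllipticCurves.ModularForms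

open DiophantineGeometry

/-! ### The printed numerics: `κ = 4π + log(163/π) ≤ 16.52`, `6κ + 16 ≤ 115.1` -/

/-- `log(163/π) ≤ 3.9502` (`163/π < 51.8847 ≤ Σ_{i<12} 3.9502^i/i! ≤ e^{3.9502}`).
[cite: VonkanelMatschke2023, Prop. 10.8 (i) (the constant κ)] -/
theorem log_div_pi_le : Real.log (163 / Real.pi) ≤ 3.9502 := by
  have hπ := Real.pi_gt_d6
  have hpos : (0 : ℝ) < 163 / Real.pi := by positivity
  rw [Real.log_le_iff_le_exp hpos]
  have h1 : 163 / Real.pi ≤ 163 / 3.141592 :=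
    div_le_div_of_nonneg_left (by norm_num) (by norm_num) hπ.le
  have h2 : (163 : ℝ) / 3.141592 ≤
      ∑ i ∈ Finset.range 12, (3.9502 : ℝ) ^ i / (i.factorial : ℝ) := by
    simp only [Finset.sum_range_succ, Finset.sum_range_zero, Nat.factorial]
    norm_num
  have h3 := Real.sum_le_exp_of_nonneg (show (0 : ℝ) ≤ 3.9502 by norm_num) 12
  linarith

/-- `κ = 4π + log(163/π) ≤ 16.516572`. [cite: VonkanelMatschke2023, Prop. 10.8 (i)] -/
theorem vkmKappa_le : vkmKappa ≤ 16.516572 := by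
  have h1 := Real.pi_lt_d6
  have h2 := log_div_pi_le
  unfold vkmKappa
  linarith

/-- **The constant of (eq:szpiro)**: `12 · (κ/2) + 16 = 6κ + 16 ≤ 115.1`.
[cite: VonkanelMatschke2023, Remark 10.10ff (eq:szpiro), constant 115.1] -/
theorem six_mul_vkmKappa_add_sixteen_le : 6 * vkmKappa + 16 ≤ 115.1 := by
  have := vkmKappa_le
  linarith

/-! ### `N_E ≥ 11` from modularity -/

/-- **Every elliptic curve over `ℚ` has conductor `N_E ≥ 11`, granted modularity**: a global minimal
model (`hasGlobalMinimalModel_rat_holds`) carries a parametrisation datum at level `N_E`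
(`nonempty_modularParametrizationData`), and the levels `1, …, 10` have genus zero, hence no datum
(`ModularParametrizationData_isEmpty_of_mem_genusZeroLevels`). [cite: DiamondShurman2005, Thm. 3.5.1 with Figure 3.3]
[cite: BCDTJAMS2001, Thm. A] -/
theorem eleven_le_conductorNorm_of_modularity (hmod : nonempty_modularParametrizationData)
    (W : WeierstrassCurve ℚ) [W.IsElliptic] : 11 ≤ W.conductorNorm ℤ := by
  obtain ⟨C, hC⟩ := hasGlobalMinimalModel_rat_holds W
  haveI := hC
  rw [← conductorNorm_smul_rat W C]
  haveI : NeZero ((C • W).conductorNorm ℤ) := ⟨(conductorNorm_pos_holds (C • W)).ne'⟩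
  obtain ⟨D⟩ := hmod (C • W)
  by_contra hlt
  push Not at hlt
  have hpos : 0 < (C • W).conductorNorm ℤ := conductorNorm_pos_holds (C • W)
  have key : ∀ n : ℕ, 0 < n → n < 11 →
      n ∈ ({1, 2, 3, 4, 5, 6, 7, 8, 9, 10, 12, 13, 16, 18, 25} : Finset ℕ) := by
    intro n h0 h1
    interval_cases n <;> decide
  exact (ModularParametrizationData_isEmpty_of_mem_genusZeroLevels (C • W) _ (key _ hpos hlt)).false D

/-! ### (eq:szpiro) from Prop. 10.8 -/

/-- **vKM (eq:szpiro) ⇐ Prop. 10.8 (i)+(ii)** (PROVED deduction, as printed after Remark 10.10: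
"Proposition 10.8 together with [vK 2014] directly implies that any elliptic curve `E` over `ℚ` of
conductor `N` and minimal discriminant `Δ_E` satisfies
`log Δ_E ≤ ν log N + (3/8) ν log log log N + (2/3) ν + 115.1`"). Proof: pass to a global minimal model
(`N_E`, `Δ_E` are invariant), take its datum at level `N_E ≥ 11` (modularity), combine
`2h(E) ≤ κ + (1/6)ν log N + (1/16)ν log₃ N + (1/9)ν` (`two_mul_height_le_of_prop_10_8`) with
`log Δ_E ≤ 12 h(E) + 16` (Silverman, `pasten2024_log_minimalDiscriminant_le_holds`) and
`6κ + 16 ≤ 115.1`. [cite: VonkanelMatschke2023, §10.5.3 display (eq:szpiro) and its derivation] -/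
theorem log_minimalDiscriminant_le_of_prop_10_8 (hmod : nonempty_modularParametrizationData)
    (hi : vonKanelMatschke_prop_10_8_i) (hii : vonKanelMatschke_prop_10_8_ii) :
    vonKanelMatschke_log_minimalDiscriminant_le := by
  intro W _
  obtain ⟨C, hC⟩ := hasGlobalMinimalModel_rat_holds W
  haveI := hC
  have hNeq : (C • W).conductorNorm ℤ = W.conductorNorm ℤ := conductorNorm_smul_rat W C
  have hΔeq : (C • W).minimalDiscriminantNorm ℤ = W.minimalDiscriminantNorm ℤ :=
    minimalDiscriminantNorm_smul_rat W C
  haveI : NeZero ((C • W).conductorNorm ℤ) := ⟨(conductorNorm_pos_holds (C • W)).ne'⟩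
  obtain ⟨D⟩ := hmod (C • W)
  have h11 : 11 ≤ (C • W).conductorNorm ℤ := by
    rw [hNeq]; exact eleven_le_conductorNorm_of_modularity hmod W
  have h2h := two_mul_height_le_of_prop_10_8 hi hii (C • W) ((C • W).conductorNorm ℤ) rfl h11 D
  have hS := pasten2024_log_minimalDiscriminant_le_holds (C • W) D.L D.isNeronLattice
  have hcast := Pasten2024.cast_minimalDiscriminantNorm_eq_abs (C • W)
  have hκ := six_mul_vkmKappa_add_sixteen_le
  rw [← hNeq, ← hΔeq, hcast]
  linarith

/-! ### The `abc` shape `log c ≪ rad log rad` from (eq:szpiro) -/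

/-- `log log log x ≤ log x` for real `x ≥ 2` (all three `Real.log`s, junk values included).
[folklore] -/
private theorem log_log_log_le_log {x : ℝ} (hx : 2 ≤ x) :
    Real.log (Real.log (Real.log x)) ≤ Real.log x := by
  have hl2 := Real.log_two_gt_d9
  have hL1 : Real.log 2 ≤ Real.log x := Real.log_le_log (by norm_num) hx
  have hL1pos : 0 < Real.log x := by linarith
  have hL2 : Real.log (Real.log x) ≤ Real.log x - 1 := Real.log_le_sub_one_of_pos hL1pos
  rcases lt_trichotomy (Real.log (Real.log x)) 0 with hneg | hzero | hpos
  · have h1 : Real.log (Real.log (Real.log x)) = Real.log (-Real.log (Real.log x)) := by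
      rw [Real.log_neg_eq_log]
    have h2 : Real.log (-Real.log (Real.log x)) ≤ -Real.log (Real.log x) - 1 :=
      Real.log_le_sub_one_of_pos (by linarith)
    have h3 : -Real.log (Real.log x) = Real.log ((Real.log x)⁻¹) := by rw [Real.log_inv]
    have h4 : Real.log ((Real.log x)⁻¹) ≤ (Real.log x)⁻¹ - 1 :=
      Real.log_le_sub_one_of_pos (inv_pos.mpr hL1pos)
    have h5 : (Real.log x)⁻¹ ≤ (Real.log 2)⁻¹ := inv_anti₀ (by linarith) hL1
    have h6 : (Real.log 2)⁻¹ < 2 := by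
      rw [inv_eq_one_div, div_lt_iff₀ (by linarith)]; linarith
    linarith
  · rw [hzero, Real.log_zero]; linarith
  · have h3 : Real.log (Real.log (Real.log x)) ≤ Real.log (Real.log x) - 1 :=
      Real.log_le_sub_one_of_pos hpos
    linarith

/-- `log log log N ≤ log N` for every natural `N ≥ 1` (`N = 1`: both sides `0`). [folklore] -/
private theorem log_log_log_natCast_le {N : ℕ} (hN : 1 ≤ N) :
    Real.log (Real.log (Real.log (N : ℝ))) ≤ Real.log (N : ℝ) := by
  rcases eq_or_lt_of_le hN with h1 | h2
  · rw [← h1]; simp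
  · exact log_log_log_le_log (by exact_mod_cast (h2 : 2 ≤ N))

/-- **(eq:szpiro) ⟹ `log c ≤ 10⁴ · rad(abc) · log rad(abc)` for EVERY `abc` triple** (PROVED; the
Frey-curve translation of vKM §10.4 / Murty–Pasten §8 with crude constants): for the global minimal Frey
model `W₀` of `exists_frey_model_sq_dvd`, `2 log c ≤ 8 log 2 + log Δ_min`, `N ≤ 2¹⁰ rad(abc)`,
`ν ≤ N`, `log log log N ≤ log N`, so (eq:szpiro) gives `2 log c ≤ 8 log 2 + (11/8) N log N + (2/3) N
+ 115.1 ≤ 2·10⁴ R log R` (`R = rad(abc) ≥ 2`). [cite: VonkanelMatschke2023, §10.4 (proof of Prop. 10.6) with (eq:szpiro)]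
[cite: MurtyPasten2013, §8] -/
theorem abcTriple_log_le_of_log_minimalDiscriminant_le
    (hsz : vonKanelMatschke_log_minimalDiscriminant_le) {a b c : ℕ} (ht : IsABCTriple a b c) :
    Real.log c ≤ 10000 * ((rad a b c : ℝ) * Real.log (rad a b c : ℕ)) := by
  obtain ⟨W₀, hE, hN, hΔ⟩ := exists_frey_model_sq_dvd ht
  haveI := hE
  have hsz' := hsz (W₀.baseChange ℚ)
  have ht' := ht
  obtain ⟨ha, hb, habc, hcop⟩ := ht'
  have hc : 0 < c := by omega
  have hΔpos : 0 < (W₀.baseChange ℚ).minimalDiscriminantNorm ℤ := minimalDiscriminantNorm_pos_holds _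
  have hNpos : 0 < (W₀.baseChange ℚ).conductorNorm ℤ := conductorNorm_pos_holds _
  have hradpos : 0 < rad a b c := by rw [rad_def]; exact Nat.radical_pos _
  have hR2 : (2 : ℝ) ≤ (rad a b c : ℝ) := by exact_mod_cast IsABCTriple.two_le_rad ht
  have hN1 : (1 : ℝ) ≤ ((W₀.baseChange ℚ).conductorNorm ℤ : ℝ) := by exact_mod_cast hNpos
  have hD0 : (0 : ℝ) < ((W₀.baseChange ℚ).minimalDiscriminantNorm ℤ : ℝ) := by exact_mod_cast hΔpos
  have hNR : ((W₀.baseChange ℚ).conductorNorm ℤ : ℝ) ≤ 1024 * (rad a b c : ℝ) := by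
    have := Nat.le_of_dvd (mul_pos (by positivity) hradpos) hN
    exact_mod_cast this
  have hc2 : (c : ℝ) ^ 2 ≤ 2 ^ 8 * ((W₀.baseChange ℚ).minimalDiscriminantNorm ℤ : ℝ) := by
    have h1 : c ≤ a * b * c := Nat.le_mul_of_pos_left c (by positivity)
    have h2 : (a * b * c) ^ 2 ≤ 2 ^ 8 * (W₀.baseChange ℚ).minimalDiscriminantNorm ℤ :=
      Nat.le_of_dvd (by positivity) hΔ
    have h3 : c ^ 2 ≤ 2 ^ 8 * (W₀.baseChange ℚ).minimalDiscriminantNorm ℤ :=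
      (Nat.pow_le_pow_left h1 2).trans h2
    exact_mod_cast h3
  have hν0 := condNu_nonneg ((W₀.baseChange ℚ).conductorNorm ℤ)
  have hνN := condNu_le_self ((W₀.baseChange ℚ).conductorNorm ℤ)
  have hl3 := log_log_log_natCast_le (N := (W₀.baseChange ℚ).conductorNorm ℤ) hNpos
  set N : ℝ := ((W₀.baseChange ℚ).conductorNorm ℤ : ℝ) with hNdef
  set D : ℝ := ((W₀.baseChange ℚ).minimalDiscriminantNorm ℤ : ℝ) with hDdef
  set R : ℝ := (rad a b c : ℝ) with hRdef
  set ν : ℝ := condNu ((W₀.baseChange ℚ).conductorNorm ℤ) with hνdef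
  have hl2 := Real.log_two_lt_d9
  have hl2' := Real.log_two_gt_d9
  have hlogN0 : 0 ≤ Real.log N := Real.log_nonneg hN1
  have hlogc : 2 * Real.log c ≤ 8 * Real.log 2 + Real.log D := by
    have h1 : Real.log ((c : ℝ) ^ 2) ≤ Real.log (2 ^ 8 * D) :=
      Real.log_le_log (by positivity) hc2
    rw [Real.log_pow, Real.log_mul (by positivity) hD0.ne', Real.log_pow] at h1
    push_cast at h1
    linarith
  have hL : Real.log 2 ≤ Real.log R := Real.log_le_log (by norm_num) hR2
  have hlogN : Real.log N ≤ 10 * Real.log 2 + Real.log R := by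
    have h1 : Real.log N ≤ Real.log (1024 * R) := Real.log_le_log (by linarith) hNR
    rw [Real.log_mul (by norm_num) (by linarith), show (1024 : ℝ) = 2 ^ 10 by norm_num,
      Real.log_pow] at h1
    push_cast at h1
    linarith
  have h1 : ν * Real.log (Real.log (Real.log N)) ≤ ν * Real.log N :=
    mul_le_mul_of_nonneg_left hl3 hν0
  have h2 : ν * Real.log N ≤ N * Real.log N := mul_le_mul_of_nonneg_right hνN hlogN0
  have hlogD : Real.log D ≤ 11 / 8 * (N * Real.log N) + 2 / 3 * N + 115.1 := by
    have h0 : Real.log D ≤ ν * Real.log N + 3 / 8 * ν * Real.log (Real.log (Real.log N)) +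
        2 / 3 * ν + 115.1 := hsz'
    nlinarith
  have hNlogN : N * Real.log N ≤ 1024 * R * (10 * Real.log 2 + Real.log R) :=
    mul_le_mul hNR hlogN hlogN0 (by positivity)
  have hX : 2 * Real.log 2 ≤ R * Real.log R := mul_le_mul hR2 hL (by linarith) (by linarith)
  have hRX : R ≤ 2 * (R * Real.log R) := by nlinarith
  have hRlog2 : R * Real.log 2 ≤ R * Real.log R := mul_le_mul_of_nonneg_left hL (by linarith)
  nlinarith

/-- **(eq:szpiro) ⟹ the Baker shape `(θ, m) = (1, 1)` with `κ = 10⁴`** (PROVED): `log c ≤ 10⁴ R log R`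
for every `abc` triple — the exponential class `Literature.Barriers.ABC.BakerShapeBound 1 1`, reached by
the modular method. [cite: VonkanelMatschke2023, §10.4 with (eq:szpiro)] -/
theorem bakerShapeBound_one_one_of_log_minimalDiscriminant_le
    (hsz : vonKanelMatschke_log_minimalDiscriminant_le) :
    Literature.Barriers.ABC.BakerShapeBound 1 1 := by
  refine ⟨10000, fun a b c ht => ?_⟩
  have h1 := abcTriple_log_le_of_log_minimalDiscriminant_le hsz ht
  rw [Real.rpow_one, pow_one]
  calc Real.log c ≤ 10000 * ((rad a b c : ℝ) * Real.log (rad a b c : ℕ)) := h1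
    _ = 10000 * (rad a b c : ℝ) * Real.log (rad a b c : ℕ) := by ring

/-- `BakerShapeBound 1 1 ⟹ EpsShapeBound 1` (`log R ≤ R^ε/ε`; the constant `κ` of the Baker shape is
`≥ 0`, tested at any triple). A shape-calculus lemma of `Literature.Barriers.ABC.BakerMethodBounds`.
[cite: Waldschmidt2014, §2 (the ε-shape of Stewart–Yu-type bounds)] -/
theorem epsShapeBound_one_of_bakerShapeBound_one_one (h : Literature.Barriers.ABC.BakerShapeBound 1 1) :
    Literature.Barriers.ABC.EpsShapeBound 1 := by
  obtain ⟨κ, hκ⟩ := h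
  intro ε hε
  refine ⟨κ / ε, 0, fun a b c ht _ => ?_⟩
  have h1 := hκ a b c ht
  rw [Real.rpow_one, pow_one] at h1
  have hR1 : (1 : ℝ) ≤ (rad a b c : ℝ) := Literature.Barriers.ABC.one_le_rad_real a b c
  have hR0 : (0 : ℝ) < (rad a b c : ℝ) := by linarith
  have hlog : Real.log (rad a b c : ℕ) ≤ (rad a b c : ℝ) ^ ε / ε := Real.log_le_rpow_div hR0.le hε
  have hκ0 : 0 ≤ κ := by
    have hc : (2 : ℝ) ≤ c := by exact_mod_cast ht.two_le
    have hlc : 0 < Real.log c := Real.log_pos (by linarith)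
    have hRl : 0 < (rad a b c : ℝ) * Real.log (rad a b c : ℕ) :=
      mul_pos hR0 (Real.log_pos (by exact_mod_cast ht.two_le_rad))
    nlinarith
  calc Real.log c ≤ κ * (rad a b c : ℝ) * Real.log (rad a b c : ℕ) := h1
    _ ≤ κ * (rad a b c : ℝ) * ((rad a b c : ℝ) ^ ε / ε) :=
        mul_le_mul_of_nonneg_left hlog (mul_nonneg hκ0 hR0.le)
    _ = κ / ε * ((rad a b c : ℝ) ^ (1 : ℝ) * (rad a b c : ℝ) ^ ε) := by rw [Real.rpow_one]; ring
    _ = κ / ε * (rad a b c : ℝ) ^ (1 + ε : ℝ) := by rw [← Real.rpow_add hR0]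

/-- **(eq:szpiro) ⟹ `EpsShapeBound 1`** (`= EpsShapeBoundOne`, the rung `A1.M2⁻`; PROVED).
[cite: VonkanelMatschke2023, §10.4 with (eq:szpiro)] -/
theorem epsShapeBound_one_of_log_minimalDiscriminant_le
    (hsz : vonKanelMatschke_log_minimalDiscriminant_le) :
    Literature.Barriers.ABC.EpsShapeBound 1 :=
  epsShapeBound_one_of_bakerShapeBound_one_one (bakerShapeBound_one_one_of_log_minimalDiscriminant_le hsz)

/-! ### Rung A1.P, von Känel–Matschke version: the `abc` shape from the three root facts -/

/-- **`BakerShapeBound 1 1` from modularity and vKM Prop. 10.8 (i)+(ii)** (PROVED assembly):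
`log c ≤ 10⁴ rad(abc) log rad(abc)` for all `abc` triples, granted BCDT modularity with an integral Manin
constant (`nonempty_modularParametrizationData`), vKM Prop. 10.8 (i) (`2h(E) − κ ≤ log m_f ≤ log r_f ≤ α`)
and (ii) (`β ≤ (1/6)ν log N + (1/16)ν log₃ N + (1/9)ν`). [cite: VonkanelMatschke2023, Prop. 10.8 and §10.4] -/
theorem bakerShapeBound_one_one_of_modularity_of_prop_10_8 (hmod : nonempty_modularParametrizationData)
    (hi : vonKanelMatschke_prop_10_8_i) (hii : vonKanelMatschke_prop_10_8_ii) :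
    Literature.Barriers.ABC.BakerShapeBound 1 1 :=
  bakerShapeBound_one_one_of_log_minimalDiscriminant_le (log_minimalDiscriminant_le_of_prop_10_8 hmod hi hii)

/-- **Rung A1.P in root-conditional kernel form (von Känel–Matschke version)** (PROVED assembly):
`EpsShapeBound 1` from {BCDT modularity, vKM Prop. 10.8 (i), vKM Prop. 10.8 (ii)} — a derivation of the
modular-method rung whose inputs are disjoint from Pasten's spectral bound Thm 7.2
(`epsShapeBound_one_of_modularity_of_thm_7_2`) beyond modularity itself.
[cite: VonkanelMatschke2023, Prop. 10.8, (eq:szpiro) and §10.4] -/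
theorem epsShapeBound_one_of_modularity_of_prop_10_8 (hmod : nonempty_modularParametrizationData)
    (hi : vonKanelMatschke_prop_10_8_i) (hii : vonKanelMatschke_prop_10_8_ii) :
    Literature.Barriers.ABC.EpsShapeBound 1 :=
  epsShapeBound_one_of_log_minimalDiscriminant_le (log_minimalDiscriminant_le_of_prop_10_8 hmod hi hii)

end Literature.NumberTheory.EllipticCurves.ModularForms

end
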